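import Summits.QuantumFields.YangMills.Theorems.LangevinControlUVFemtoCurvatureTwoPointCHyperplaneTwist
import Summits.QuantumFields.YangMills.Theorems.LangevinControlUVFemtoCurvatureTwoPointCCornerOneSitePartitionDoubling
import Summits.QuantumFields.YangMills.Theorems.LangevinControlUVFemtoCurvatureTwoPointStubVarianceOfChessboardDoubling
import HarnessLib

/-!
# Route `LangevinControlUV`, crux `FemtoCurvatureTwoPointC` (stmt-QuantumFields-16204), line
# `conditional-covariance-floor` — V-corner: the HOLONOMY-CONDITIONED Gaussian lower bound of the
# torus partition function

Registered sub-goal `torus_lower_axisHolonomy` (`--supports stmt-QuantumFields-16204`), proved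
verbatim: for a compact second-countable group `G` with a faithful continuous unitary lattice
representation `r` (`D = dimE r.ρ`) there are `C₁ > 0` and `A` (`= 96`) with

  `e^{−A L⁴} (C₁ b^{−D/2})^{3L⁴−3} · Z₁(2L² b) ≤ Z_L(b)`   for all `L ≥ 2`, `b ≥ 1`,

`Z_L = partitionFunction (L := L)` the Wilson partition function of the torus `(ℤ/L)⁴` and
`Z₁ = partitionFunction (L := 1)` the ONE-SITE partition function, i.e. the Haar integral of the
Boltzmann weight of the commutator cost `f(a) = Σ_{μ<ν} (N − Re tr r(a_μ a_ν a_μ⁻¹ a_ν⁻¹))` on `G⁴`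
(`OneSite.wilsonAction_eq_commutatorCost`).

**Why.** This is the lower half of the holonomy-conditioned torus sandwich of the V-corner attack
(notes `Vc-notes.md` §(c)): unlike the landed `torusPartitionFunction_lower` (exponent `3L⁴ + 1`, all
off-comb links localised), the four AXIS WRAP links `a_μ = ((L−1)e_μ, μ)` — the based axis holonomies
in the comb gauge — are NOT localised; their marginal is kept exactly and appears as the one-site
weight at temperature `2L²b`. Together with the conditioned upper bound (temperature `b/(4L²)`, lattice
Stokes) and the iterated one-site doubling this yields the uniform doubling
`Z_L(β/2) ≤ e^{A L⁴} Z_L(β)` on ALL boxes, hence the corner stub V.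

**Proof** (`twist_lower_master`, master form in `δ`). Comb gauge:
`Z_L(b) = ∫_{G^{combᶜ}} e^{−b S(ext W)} dW` (`partitionFunction_eq_lintegral_combGauge`). For a background
`W = x` with axis quadruple `a = (x(a_μ))_μ`, integrate out the `3L⁴ − 3` inner coordinates `s`
(`MeasureTheory.lmarginal`) restricted to the product ball
`B = {y | ‖r(y_i) − r(Ū(a)_i)‖ ≤ δ ∀ i ∈ s}` around the HYPERPLANE TWIST `Ū(a)` (file
`…CHyperplaneTwist`): there every link of `ext(x ⊔ y)` is `δ`-close to `Ū(a)` (comb links and axis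
links exactly), so `S ≤ 2 S(Ū(a)) + 96 δ² L⁴ = 2L² f(a) + 96 δ² L⁴`
(`TwistLower.wilsonAction_le_two_mul_add_of_near`, `TwistLower.wilsonAction_twist`), while
`Haar^{⊗s}(B) = Haar{‖r g − 1‖ ≤ δ}^{3L⁴−3}` (left invariance, `haar_setOf_norm_sub_le`). The marginal
comparison `MeasureTheory.lintegral_le_of_lmarginal_le` then bounds `Z_L(b)` below by
`e^{−96bδ²L⁴} Haar{…}^{3L⁴−3} ∫ e^{−2L²b f(a(W))} dW`, and the law of the axis quadruple under product
Haar is product Haar (`pi_map_proj_eq_pi`), so the last integral is `Z₁(2L²b)`. The registered form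
takes `δ = b^{−1/2}` and the small-ball bound `Haar{‖r g − 1‖ ≤ δ} ≥ C₁ δ^D` (`exists_haar_gball_ge`).

Everything is proved from Mathlib and landed tree files; no named facts, no definitions.
-/

set_option autoImplicit false

noncomputable section

open scoped Matrix.Norms.Frobenius ENNReal
open MeasureTheory
open Literature.MathematicalPhysics.QuantumFieldTheory
open Summit.QuantumFields.YangMills.Theorems.FreeEnergyLogCoefficient (dimE exists_haar_gball_ge)
open Summit.QuantumFields.YangMills.Theorems.FemtoCurvatureTwoPoint.DoublingOfRV (card_plaquette)
open Summit.QuantumFields.YangMills.Theorems.FemtoCurvatureTwoPoint.PlaquetteVariance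
  (partitionFunction_toReal_pos)

namespace Summit.QuantumFields.YangMills.Theorems.FemtoCurvatureTwoPointC.TorusGauge

/-! ### Projections of product probability measures -/

section Proj

/-- **Distinct coordinates of a product probability measure are jointly product-distributed**:
reading off the coordinates `j k` (`j` injective) pushes `μ^{⊗ι}` forward to `μ^{⊗κ}`. -/
theorem pi_map_proj_eq_pi {ι κ : Type*} [Fintype ι] [Fintype κ] {X : Type*} [MeasurableSpace X]
    (μ : MeasureTheory.Measure X) [MeasureTheory.IsProbabilityMeasure μ] {j : κ → ι}
    (hj : Function.Injective j) :
    (MeasureTheory.Measure.pi fun _ : ι => μ).map (fun (W : ι → X) (k : κ) => W (j k)) =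
      MeasureTheory.Measure.pi fun _ : κ => μ := by
  classical
  have hmeas : Measurable fun (W : ι → X) (k : κ) => W (j k) :=
    measurable_pi_lambda _ fun k => measurable_pi_apply (j k)
  refine (MeasureTheory.Measure.pi_eq fun s hs => ?_).symm
  rw [MeasureTheory.Measure.map_apply hmeas (MeasurableSet.univ_pi hs)]
  have hpre : (fun (W : ι → X) (k : κ) => W (j k)) ⁻¹' Set.pi Set.univ s =
      Set.pi Set.univ fun i => {x : X | ∀ k, j k = i → x ∈ s k} := by
    ext W
    simp only [Set.mem_preimage, Set.mem_univ_pi, Set.mem_setOf_eq]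
    constructor
    · rintro h i k rfl
      exact h k
    · intro h k
      exact h (j k) k rfl
  rw [hpre, MeasureTheory.Measure.pi_pi]
  have hoff : ∀ i ∈ (Finset.univ : Finset ι), i ∉ Finset.univ.image j →
      μ {x : X | ∀ k, j k = i → x ∈ s k} = 1 := by
    intro i _ hi
    have : {x : X | ∀ k, j k = i → x ∈ s k} = Set.univ := by
      ext x
      simp only [Set.mem_setOf_eq, Set.mem_univ, iff_true]
      rintro k rfl
      exact absurd (Finset.mem_image_of_mem j (Finset.mem_univ k)) hi
    rw [this, MeasureTheory.measure_univ]
  rw [← Finset.prod_subset (Finset.subset_univ (Finset.univ.image j)) hoff,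
    Finset.prod_image fun k _ k' _ h => hj h]
  refine Finset.prod_congr rfl fun k _ => ?_
  congr 1
  ext x
  simp only [Set.mem_setOf_eq]
  constructor
  · intro h
    exact h k rfl
  · rintro h k' hk'
    obtain rfl := hj hk'
    exact h

end Proj

/-! ### The holonomy-conditioned Gaussian lower bound -/

section Lower

variable {G : Type} [Group G] [TopologicalSpace G] [IsTopologicalGroup G] [CompactSpace G]
  [MeasurableSpace G] [BorelSpace G] [SecondCountableTopology G]

/-- **Holonomy-conditioned Gaussian lower bound, master form.** For every torus `(ℤ/L)⁴`, `b ≥ 0`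
and `δ ≥ 0`:
`e^{−96 b δ² L⁴} · Haar{‖r g − 1‖ ≤ δ}^{3L⁴−3} · Z₁(2L²b) ≤ Z_L(b)`, `Z₁` the one-site partition
function. Comb gauge (`partitionFunction_eq_lintegral_combGauge`); integrate out the `3L⁴ − 3`
inner links restricted to the `δ`-balls around the hyperplane twist `Ū(a)` of the four axis wrap
links `a` (`TwistLower.wilsonAction_le_two_mul_add_of_near`, `TwistLower.wilsonAction_twist`:
`S ≤ 2L² f(a) + 96 δ² L⁴` there), by a one-step marginal comparison
(`MeasureTheory.lintegral_le_of_lmarginal_le`); the law of `a` is product Haar (`pi_map_proj_eq_pi`)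
and `∫ e^{−2L²b f} dHaar⁴ = Z₁(2L²b)` (`OneSite.wilsonAction_eq_commutatorCost`). -/
theorem twist_lower_master (r : LatticeRep G) (L : ℕ) [NeZero L] {b δ : ℝ} (hb : 0 ≤ b)
    (hδ : 0 ≤ δ) :
    ENNReal.ofReal (Real.exp (-(b * (96 * δ ^ 2 * (L : ℝ) ^ 4)))) *
        haarProbability G {g : G | ‖r.ρ g - 1‖ ≤ δ} ^ (3 * L ^ 4 - 3) *
        partitionFunction (d := 4) (L := 1) r.ρ (2 * (L : ℝ) ^ 2 * b) ≤
      partitionFunction (d := 4) (L := L) r.ρ b := by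
  classical
  -- the axis coordinates `J μ`, the projection `P` to a one-site configuration, the inner links `s`
  let J : Fin 4 → {e : Edge 4 L // e ∉ combEdges L} := fun μ =>
    ⟨((Pi.single μ (((L - 1 : ℕ) : ZMod L)) : Site 4 L), μ), TwistLower.axis_notMem_combEdges μ⟩
  let P : ({e : Edge 4 L // e ∉ combEdges L} → G) → GaugeConfig 4 1 G := fun W e' => W (J e'.2)
  let s : Finset {e : Edge 4 L // e ∉ combEdges L} := Finset.univ.filter fun i =>
    ∀ μ : Fin 4, i.1 ≠ ((Pi.single μ (((L - 1 : ℕ) : ZMod L)) : Site 4 L), μ)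
  have hJs : ∀ μ, J μ ∉ s := fun μ h => by
    have h' := (Finset.mem_filter.1 h).2 μ
    exact h' rfl
  have hs_card : s.card = 3 * L ^ 4 - 3 := TwistLower.card_inner
  -- the integrand of the comb-gauge reduction and the comparison function
  let F : ({e : Edge 4 L // e ∉ combEdges L} → G) → ℝ≥0∞ := fun W => ENNReal.ofReal (Real.exp
    (-b * wilsonAction r.ρ (fun e : Edge 4 L => if h : e ∈ combEdges L then (1 : G) else W ⟨e, h⟩)))
  let K : ℝ≥0∞ := ENNReal.ofReal (Real.exp (-(b * (96 * δ ^ 2 * (L : ℝ) ^ 4)))) *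
    haarProbability G {g : G | ‖r.ρ g - 1‖ ≤ δ} ^ (3 * L ^ 4 - 3)
  let Gf : ({e : Edge 4 L // e ∉ combEdges L} → G) → ℝ≥0∞ := fun W =>
    K * ENNReal.ofReal (Real.exp (-(2 * (L : ℝ) ^ 2 * b) * wilsonAction r.ρ (P W)))
  have hP : Measurable P := measurable_pi_lambda _ fun e' => measurable_pi_apply (J e'.2)
  have hF : Measurable F :=
    ENNReal.measurable_ofReal.comp (Real.measurable_exp.comp
      (((WilsonRP.measurable_wilsonAction r.ρ r.continuous).comp measurable_combExtend).const_mul _))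
  have hE : Measurable fun V : GaugeConfig 4 1 G =>
      ENNReal.ofReal (Real.exp (-(2 * (L : ℝ) ^ 2 * b) * wilsonAction r.ρ V)) :=
    ENNReal.measurable_ofReal.comp (Real.measurable_exp.comp
      ((WilsonRP.measurable_wilsonAction r.ρ r.continuous).const_mul _))
  have hGf : Measurable Gf := (hE.comp hP).const_mul K
  -- (1) `∫ Gf = K · Z₁(2L²b)`: the law of the axis quadruple is product Haar
  have hlaw : (MeasureTheory.Measure.pi fun _ : {e : Edge 4 L // e ∉ combEdges L} =>
      haarProbability G).map P = MeasureTheory.Measure.pi fun _ : Edge 4 1 => haarProbability G := by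
    refine pi_map_proj_eq_pi (haarProbability G) (j := fun e' : Edge 4 1 => J e'.2) ?_
    intro e₁ e₂ h
    have h2 : e₁.2 = e₂.2 := congrArg (fun i : {e : Edge 4 L // e ∉ combEdges L} => i.1.2) h
    exact Prod.ext (Subsingleton.elim _ _) h2
  have hint : ∫⁻ W, Gf W ∂(MeasureTheory.Measure.pi fun _ : {e : Edge 4 L // e ∉ combEdges L} =>
      haarProbability G) = K * partitionFunction (d := 4) (L := 1) r.ρ (2 * (L : ℝ) ^ 2 * b) := by
    have hEP : Measurable fun W : {e : Edge 4 L // e ∉ combEdges L} → G =>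
        ENNReal.ofReal (Real.exp (-(2 * (L : ℝ) ^ 2 * b) * wilsonAction r.ρ (P W))) := hE.comp hP
    show ∫⁻ W, K * ENNReal.ofReal (Real.exp (-(2 * (L : ℝ) ^ 2 * b) * wilsonAction r.ρ (P W))) ∂_ = _
    rw [MeasureTheory.lintegral_const_mul K hEP, OneSite.partitionFunction_eq_lintegral',
      ← hlaw, MeasureTheory.lintegral_map hE hP]
  -- (2) the one-step marginal comparison over the inner links
  have hcmp : MeasureTheory.lmarginal (fun _ => haarProbability G) s Gf ≤
      MeasureTheory.lmarginal (fun _ => haarProbability G) s F := by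
    intro x
    -- the hyperplane twist of the axis quadruple of `x`
    let Ubar : GaugeConfig 4 L G := fun e => if (e.1 e.2).val + 1 < L then 1 else x (J e.2)
    have hUbar : ∀ e : Edge 4 L, Ubar e = if (e.1 e.2).val + 1 < L then 1 else
        (fun μ => x (J μ)) e.2 := fun e => rfl
    have hSbar : wilsonAction r.ρ Ubar = (L : ℝ) ^ 2 * wilsonAction r.ρ (P x) := by
      rw [TwistLower.wilsonAction_twist r.ρ (fun μ => x (J μ)) hUbar,
        OneSite.wilsonAction_eq_commutatorCost]
    -- the product ball of the inner links around the twist, and its mass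
    let B : Set (↥s → G) := Set.pi Set.univ fun i => {g : G | ‖r.ρ g - r.ρ (Ubar i.1.1)‖ ≤ δ}
    have hBm : MeasurableSet B := MeasurableSet.univ_pi fun i =>
      measurableSet_le (FreeEnergyLogCoefficient.continuous_norm_rho_sub r.ρ r.continuous _).measurable
        measurable_const
    have hBvol : (MeasureTheory.Measure.pi fun _ : ↥s => haarProbability G) B =
        haarProbability G {g : G | ‖r.ρ g - 1‖ ≤ δ} ^ (3 * L ^ 4 - 3) := by
      show (MeasureTheory.Measure.pi fun _ : ↥s => haarProbability G) (Set.pi Set.univ _) = _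
      rw [MeasureTheory.Measure.pi_pi]
      simp only [FreeEnergyLogCoefficient.haar_setOf_norm_sub_le r.ρ r.mem_unitary]
      rw [Finset.prod_const, Finset.card_univ, Fintype.card_coe, hs_card]
    -- the constant lower bound on the ball
    let c : ℝ≥0∞ := ENNReal.ofReal (Real.exp (-(b * (96 * δ ^ 2 * (L : ℝ) ^ 4)))) *
      ENNReal.ofReal (Real.exp (-(2 * (L : ℝ) ^ 2 * b) * wilsonAction r.ρ (P x)))
    have hlow : ∀ y ∈ B, c ≤ F (Function.updateFinset x s y) := by
      intro y hy
      -- every link of the updated configuration is `δ`-close to the twist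
      have hnear : ∀ e : Edge 4 L, ‖r.ρ ((fun e : Edge 4 L => if h : e ∈ combEdges L then (1 : G)
          else Function.updateFinset x s y ⟨e, h⟩) e) - r.ρ (Ubar e)‖ ≤ δ := by
        intro e
        by_cases he : e ∈ combEdges L
        · simp only [dif_pos he]
          rw [TwistLower.twist_eq_one_of_mem_combEdges (fun μ => x (J μ)) (Ubar := Ubar) hUbar he,
            sub_self, norm_zero]
          exact hδ
        · simp only [dif_neg he]
          by_cases hi : (⟨e, he⟩ : {e : Edge 4 L // e ∉ combEdges L}) ∈ s
          · have hyi := (Set.mem_univ_pi.1 hy) ⟨⟨e, he⟩, hi⟩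
            simp only [Function.updateFinset, dif_pos hi]
            exact hyi
          · simp only [Function.updateFinset, dif_neg hi]
            have hax : ∃ μ : Fin 4, e = ((Pi.single μ (((L - 1 : ℕ) : ZMod L)) : Site 4 L), μ) := by
              by_contra hne
              exact hi (Finset.mem_filter.2 ⟨Finset.mem_univ _, fun μ hμ => hne ⟨μ, hμ⟩⟩)
            obtain ⟨μ, rfl⟩ := hax
            rw [TwistLower.twist_axis (fun μ => x (J μ)) (Ubar := Ubar) hUbar μ, sub_self, norm_zero]
            exact hδ
      have hS := TwistLower.wilsonAction_le_two_mul_add_of_near r.ρ r.mem_unitary hnear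
      rw [hSbar, card_plaquette] at hS
      push_cast at hS
      show ENNReal.ofReal _ * ENNReal.ofReal _ ≤ ENNReal.ofReal _
      rw [← ENNReal.ofReal_mul (Real.exp_pos _).le, ← Real.exp_add]
      refine ENNReal.ofReal_le_ofReal (Real.exp_le_exp.2 ?_)
      have h96 : 0 ≤ b * (96 * δ ^ 2 * (L : ℝ) ^ 4) := by positivity
      nlinarith [mul_le_mul_of_nonneg_left hS hb]
    -- compare the two marginals at `x`
    calc MeasureTheory.lmarginal (fun _ => haarProbability G) s Gf x
        = ∫⁻ _y : ↥s → G, Gf x ∂(MeasureTheory.Measure.pi fun _ : ↥s => haarProbability G) := by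
          refine MeasureTheory.lintegral_congr fun y => ?_
          show K * ENNReal.ofReal (Real.exp (-(2 * (L : ℝ) ^ 2 * b) *
              wilsonAction r.ρ (P (Function.updateFinset x s y)))) =
            K * ENNReal.ofReal (Real.exp (-(2 * (L : ℝ) ^ 2 * b) * wilsonAction r.ρ (P x)))
          have hPy : P (Function.updateFinset x s y) = P x := by
            funext e'
            show Function.updateFinset x s y (J e'.2) = x (J e'.2)
            simp only [Function.updateFinset, dif_neg (hJs e'.2)]
          rw [hPy]
      _ = c * haarProbability G {g : G | ‖r.ρ g - 1‖ ≤ δ} ^ (3 * L ^ 4 - 3) := by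
          rw [MeasureTheory.lintegral_const, MeasureTheory.measure_univ, mul_one]
          show K * _ = c * _
          simp only [K, c]
          ring
      _ = ∫⁻ y, B.indicator (fun _ => c) y ∂(MeasureTheory.Measure.pi fun _ : ↥s => haarProbability G) := by
          rw [MeasureTheory.lintegral_indicator_const hBm, hBvol]
      _ ≤ ∫⁻ y, F (Function.updateFinset x s y)
            ∂(MeasureTheory.Measure.pi fun _ : ↥s => haarProbability G) := by
          refine MeasureTheory.lintegral_mono fun y => ?_
          by_cases hy : y ∈ B
          · rw [Set.indicator_of_mem hy]
            exact hlow y hy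
          · rw [Set.indicator_of_notMem hy]
            exact bot_le
      _ = MeasureTheory.lmarginal (fun _ => haarProbability G) s F x := rfl
  -- (3) assemble
  calc ENNReal.ofReal (Real.exp (-(b * (96 * δ ^ 2 * (L : ℝ) ^ 4)))) *
        haarProbability G {g : G | ‖r.ρ g - 1‖ ≤ δ} ^ (3 * L ^ 4 - 3) *
        partitionFunction (d := 4) (L := 1) r.ρ (2 * (L : ℝ) ^ 2 * b)
      = ∫⁻ W, Gf W ∂(MeasureTheory.Measure.pi fun _ : {e : Edge 4 L // e ∉ combEdges L} =>
          haarProbability G) := hint.symm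
    _ ≤ ∫⁻ W, F W ∂(MeasureTheory.Measure.pi fun _ : {e : Edge 4 L // e ∉ combEdges L} =>
          haarProbability G) := MeasureTheory.lintegral_le_of_lmarginal_le s hGf hF hcmp
    _ = partitionFunction (d := 4) (L := L) r.ρ b :=
        (partitionFunction_eq_lintegral_combGauge r.ρ r.continuous b).symm

end Lower

/-! ### The registered statement -/

/-- **Holonomy-conditioned Gaussian lower bound for the torus partition function** (registered
sub-goal `torus_lower_axisHolonomy` of line `conditional-covariance-floor`, V-corner attack):
there are `C₁ > 0` (the small-ball constant of `r`) and `A` (`= 96`) such that for every torus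
`(ℤ/L)⁴`, `L ≥ 2`, and every `b ≥ 1`,
`e^{−A L⁴} (C₁ b^{−D/2})^{3L⁴−3} · Z₁(2L² b) ≤ Z_L(b)`, `D = dimE r.ρ`, `Z₁` the ONE-SITE partition
function `partitionFunction (L := 1)` (Wilson's action on `(ℤ/1)⁴` = the commutator cost of the
four axis holonomies) — the master form `twist_lower_master` at the Gaussian scale `δ = b^{−1/2}`
with the small-ball bound `Haar{‖r g − 1‖ ≤ δ} ≥ C₁ δ^D` (`exists_haar_gball_ge`). Compared with
`torusPartitionFunction_lower` (exponent `3L⁴ + 1`) the four axis wrap links are NOT localised: their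
marginal is kept exactly, as the one-site Boltzmann weight at temperature `2L²b`. -/
theorem torus_lower_axisHolonomy :
    ∀ {G : Type} [Group G] [TopologicalSpace G] [IsTopologicalGroup G] [CompactSpace G]
      [MeasurableSpace G] [BorelSpace G] [SecondCountableTopology G] (r : LatticeRep G),
      ∃ C₁ A : ℝ, 0 < C₁ ∧ ∀ (L : ℕ) [NeZero L] (b : ℝ), 2 ≤ L → 1 ≤ b →
        Real.exp (-(A * (L : ℝ) ^ 4)) * (C₁ * b ^ (-((dimE r.ρ : ℝ) / 2))) ^ (3 * L ^ 4 - 3) *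
            (partitionFunction (d := 4) (L := 1) r.ρ (2 * (L : ℝ) ^ 2 * b)).toReal ≤
          (partitionFunction (d := 4) (L := L) r.ρ b).toReal := by
  intro G _ _ _ _ _ _ _ r
  obtain ⟨C₁, hC₁, hball⟩ := exists_haar_gball_ge r.ρ r.continuous r.injective r.mem_unitary
  refine ⟨C₁, 96, hC₁, fun L _ b _ hb => ?_⟩
  have hb0 : 0 < b := by linarith
  -- the Gaussian scale `δ = b^{-1/2}`
  have hδ0 : 0 < b ^ (-(1 / 2 : ℝ)) := Real.rpow_pos_of_pos hb0 _
  have hδ1 : b ^ (-(1 / 2 : ℝ)) ≤ 1 := Real.rpow_le_one_of_one_le_of_nonpos hb (by norm_num)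
  have hδD : (b ^ (-(1 / 2 : ℝ))) ^ dimE r.ρ = b ^ (-((dimE r.ρ : ℝ) / 2)) := by
    rw [← Real.rpow_natCast, ← Real.rpow_mul hb0.le]
    congr 1
    ring
  have hδ2 : b * (b ^ (-(1 / 2 : ℝ))) ^ 2 = 1 := by
    have h2 : (b ^ (-(1 / 2 : ℝ))) ^ 2 = b⁻¹ := by
      rw [← Real.rpow_natCast, ← Real.rpow_mul hb0.le, ← Real.rpow_neg_one]
      norm_num
    rw [h2, mul_inv_cancel₀ hb0.ne']
  have hmaster := twist_lower_master r L hb0.le hδ0.le (δ := b ^ (-(1 / 2 : ℝ)))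
  -- finiteness and positivity
  have hZpos := partitionFunction_toReal_pos (d := 4) (L := L) r.ρ r.continuous b
  have hZtop : partitionFunction (d := 4) (L := L) r.ρ b ≠ ⊤ := (ENNReal.toReal_pos_iff.1 hZpos).2.ne
  have hreal := ENNReal.toReal_mono hZtop hmaster
  rw [ENNReal.toReal_mul, ENNReal.toReal_mul, ENNReal.toReal_pow,
    ENNReal.toReal_ofReal (Real.exp_pos _).le] at hreal
  -- the small-ball bound `C₁ δ^D ≤ Haar{‖r g − 1‖ ≤ δ}`
  have h1 : C₁ * b ^ (-((dimE r.ρ : ℝ) / 2)) ≤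
      (haarProbability G {g : G | ‖r.ρ g - 1‖ ≤ b ^ (-(1 / 2 : ℝ))}).toReal := by
    rw [← hδD]
    exact (ENNReal.ofReal_le_iff_le_toReal (MeasureTheory.measure_ne_top _ _)).1 (hball _ hδ0 hδ1)
  have h0 : 0 ≤ C₁ * b ^ (-((dimE r.ρ : ℝ) / 2)) :=
    (mul_pos hC₁ (Real.rpow_pos_of_pos hb0 _)).le
  have hexp : Real.exp (-(96 * (L : ℝ) ^ 4)) =
      Real.exp (-(b * (96 * (b ^ (-(1 / 2 : ℝ))) ^ 2 * (L : ℝ) ^ 4))) := by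
    congr 1
    have : b * (96 * (b ^ (-(1 / 2 : ℝ))) ^ 2 * (L : ℝ) ^ 4) =
        96 * (b * (b ^ (-(1 / 2 : ℝ))) ^ 2) * (L : ℝ) ^ 4 := by ring
    rw [this, hδ2, mul_one]
  calc Real.exp (-(96 * (L : ℝ) ^ 4)) * (C₁ * b ^ (-((dimE r.ρ : ℝ) / 2))) ^ (3 * L ^ 4 - 3) *
        (partitionFunction (d := 4) (L := 1) r.ρ (2 * (L : ℝ) ^ 2 * b)).toReal
      ≤ Real.exp (-(b * (96 * (b ^ (-(1 / 2 : ℝ))) ^ 2 * (L : ℝ) ^ 4))) *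
          (haarProbability G {g : G | ‖r.ρ g - 1‖ ≤ b ^ (-(1 / 2 : ℝ))}).toReal ^ (3 * L ^ 4 - 3) *
          (partitionFunction (d := 4) (L := 1) r.ρ (2 * (L : ℝ) ^ 2 * b)).toReal := by
        rw [hexp]
        gcongr
    _ ≤ (partitionFunction (d := 4) (L := L) r.ρ b).toReal := hreal


end Summit.QuantumFields.YangMills.Theorems.FemtoCurvatureTwoPointC.TorusGauge

end
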